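import Summits.BirchSwinnertonDyer.Rank1Residual.X11b.BDPRouteLocalKernelExactArith
import Summits.BirchSwinnertonDyer.Rank1Residual.X11b.BDPRouteNonsingularTorsionDivisible
import Summits.BirchSwinnertonDyer.Rank1Residual.X11b.LocalKernelCoinvariantsExact
import Summits.BirchSwinnertonDyer.Rank1Residual.X11b.AnticyclotomicControlAtoms
import HarnessLib

/-!
# Class X11b, route p2: Greenberg's Lemma 3.3 EXACT — the coinvariant identity
# `[B_v : (γ_v − 1)B_v] = c_v^{(p)} · [T_B : (γ_v − 1)T_B]` at every `v ∤ p`, and atom (P11)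
# `LocalKernelOrderAt` modulo the inflation–restriction transport (cell `b2b-bsdres`,
# sub-cell `multr1-p2`, gen 20)

HONEST FRAMING (verbatim, cell `b2b-bsdres`): the goal of the cell is to DELETE the
COMBINATION-SHAPED residual classes for ALL analytic-rank `≤ 1` curves over `ℚ` — "full BSD
formula for every rank `≤ 1` curve in class `C`" assembled STRICTLY from published theorems — so
that the rank-`≤ 1` remainder becomes exactly the CONSTRUCTION-SHAPED classes, which are TYPED
(missing-input Props), NOT attempted; this is not "finishing BSD". Research route `p2` for class
X11b; no claim beyond the stated class; nothing booked; X11b stays CONSTRUCTION-SHAPED. Theorems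
only; no definition, no named fact, no `sorry`.

## What is proved (Greenberg, LNM 1716, proof of Thm. 4.1, p. 74: "`ker r_v` has order `c_v^{(p)}`")

Notation of gens 13–14: `B_v = E[p^∞]^{ker κ ⊓ D_v}`, `γ_v − 1 = decompSubOne κ _ γ_v` (`γ_v` a
topological generator of `D_v` modulo `D_v ⊓ ker κ`), `M₀ = nonsingularPart ≤ E(K̄)^{I_v}` (gen 14),
`T_B = B_v ∩ M₀` (legitimate: `I_v ≤ ker κ ⊓ D_v` at `v ∤ p`). The arithmetic (the `D_v`-fixed
`p`-power torsion is `X(K_v)[p^∞]`, `M₀` matching `X₀(K_v)`; local purity count) is the companion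
`BDPRouteLocalKernelExactArith` / `BDPRouteLocalTorsionPurity`.

* **`index_range_primary_eq_mul`** — snake identity (`BDPRouteLocalKernelSnake`) + arithmetic:
  `[B_v : (γ_v − 1)B_v] = [T_B : (γ_v − 1)T_B] · p ^ ord_p c_v` (`ker(γ_v − 1) = E(K_v)[p^∞]`).
* **`pow_padicValNat_localTamagawaNumber_dvd_index_range_decompSubOne`** — DATA-FREE:
  `p ^ ord_p c_v ∣ [B_v : (γ_v − 1)B_v]` at every `v ∤ p`, every reduction type, every `ℤ_p`-extension.
* **`index_range_decompSubOne_eq_pow`** — `[B_v : (γ_v − 1)B_v] = p ^ ord_p c_v` at every `v ∤ p`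
  NOT split completely in `K_∞` (`¬ D_v ≤ ker κ`): the divisibility, gen 14's `#ker r_v ≤ c_v^{(p)}`
  and the sibling sub-cell's inflation–restriction EQUALITY `#ker r_v = #(B_v/(γ_v − 1)B_v)`
  (`natCard_localKer_eq_natCard_quotient_range_decompSubOne`, multr1-p1, `LocalKernelCoinvariantsExact`)
  squeeze the index — NO Tate curve, NO Néron filtration up the tower, NO pro-prime-to-`p` averaging.
* **`localKernelOrderAt_of_natCard_localKer_eq`**, **`localKernelOrderAt_of_not_le`** — atom (P11)
  of route R1, `LocalKernelOrderAt W p κ v` (`#ker r_v = p ^ ord_p c_v`, JSW17 Prop. 3.3.4 Case 1(a)),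
  DISCHARGED for every elliptic `E/K`, every `ℤ_p`-extension `κ`, every finite place `v ∤ p` that
  does not split completely in `K_∞/K`.

CONDITIONAL use only; nothing booked; reach and labels unchanged. (P11) is a PUB-shaped input of
route R1's control identity (`controlOnTreeAt_of_atoms`; `R1.bsdp_of_onTree_facts` off
`LocallyTrivialAt`); this file removes it wherever the finite-decomposition hypothesis is available.

References: [GreenbergLNM1716] §3 Lemma 3.3 (p. 87), §4 proof of Thm. 4.1 (p. 74); [SilvermanAEC2009]
VII.2.1, VII.3.1, VII.6.1–6.2; [JetchevSkinnerWan2017] Prop. 3.3.4 Case 1(a) (arXiv:1512.06894 pp. 12–13).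
-/

noncomputable section

open scoped Classical NNReal

open NumberField IsDedekindDomain Field IsDedekindDomain.HeightOneSpectrum WeierstrassCurve
open Literature.NumberTheory.EllipticCurves Literature.NumberTheory.EllipticCurves.GreenbergSelmer
open Literature.NumberTheory.GaloisRepresentations

universe u

namespace Summit.BirchSwinnertonDyer.Rank1Residual.X11b.AcSelmer

/-! ## The coinvariant identity on `B_v = E[p^∞]^{ker κ ⊓ D_v}` -/

section Coinvariants

variable {K : Type u} [Field K] [NumberField K] (W : WeierstrassCurve K) {p : ℕ} [Fact p.Prime]
  (κ : ZpExtension K p) {v : HeightOneSpectrum (𝓞 K)}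
  {w : Valuation (AlgebraicClosure (v.adicCompletion K)) ℝ≥0}
  (hw : ∀ x, (w x : ℝ) =
    spectralNorm (v.adicCompletion K) (AlgebraicClosure (v.adicCompletion K)) x)
  {W₀ : WeierstrassCurve w.integer}
  (hW₀ : ((W.localMinimalIntegralModel v).map (algebraMap (v.adicCompletionIntegers K)
      (v.adicCompletion K))).baseChange (AlgebraicClosure (v.adicCompletion K)) =
    W₀.baseChange (AlgebraicClosure (v.adicCompletion K)))
  {Φ : localPoints W (v.adicCompletion K) ≃+
    (((W.localMinimalIntegralModel v).map (algebraMap (v.adicCompletionIntegers K)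
      (v.adicCompletion K))).baseChange (AlgebraicClosure (v.adicCompletion K))).toAffine.Point}
  (hΦ : ∀ (σ : absoluteGaloisGroup (v.adicCompletion K)) (Q : localPoints W (v.adicCompletion K)),
    Φ (σ • Q) = Affine.Point.map ((absoluteGaloisGroup.toAlgEquiv _ σ :
        AlgebraicClosure (v.adicCompletion K) ≃ₐ[v.adicCompletion K]
          AlgebraicClosure (v.adicCompletion K)) :
        AlgebraicClosure (v.adicCompletion K) →ₐ[v.adicCompletion K]
          AlgebraicClosure (v.adicCompletion K)) (Φ Q))

/-- `E(K̄)^{ker κ ⊓ D_v} ≤ E(K̄)^{I_v}` for `v ∤ p` (`I_v ≤ ker κ`: a `ℤ_p`-extension is unramified at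
`v ∤ p`, tree `ZpExtension.inertia_le_kerSubgroup_holds`; `I_v ≤ D_v`). [cite: Washington1997, Prop. 13.2] -/
theorem fixedPoints_kerSubgroup_inf_decomp_le_fixedPoints_inertia
    (hpv : (p : 𝓞 K) ∉ v.asIdeal) :
    FixedPoints.addSubgroup ↥(κ.kerSubgroup ⊓ decomp v) W.geomPoints ≤
      FixedPoints.addSubgroup ↥((adicCompletionPrime K v).inertia (absoluteGaloisGroup K))
        W.geomPoints := by
  intro m hm x
  have hIker : (adicCompletionPrime K v).inertia (absoluteGaloisGroup K) ≤ κ.kerSubgroup :=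
    ZpExtension.inertia_le_kerSubgroup_holds K p κ hpv (adicCompletionPrime_mem_primesAbove K v)
  have hIdec : (adicCompletionPrime K v).inertia (absoluteGaloisGroup K) ≤ decomp v := by
    intro i hi
    rw [decomp_eq_decompositionSubgroup_adicCompletionPrime]
    exact Ideal.inertia_le_decompositionSubgroup _ _ hi
  exact hm ⟨(x : absoluteGaloisGroup K), Subgroup.mem_inf.mpr ⟨hIker x.2, hIdec x.2⟩⟩

include hw hΦ in
/-- **The coinvariant identity (Greenberg's Lemma 3.3 EXACT, algebraic–arithmetic half).** With
`M = E(K̄)^{ker κ ⊓ D_v}`, `φ = γ_v − 1` on it (`γ_v` a topological generator of `D_v` modulo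
`D_v ⊓ ker κ`), `B = M[p^∞]` (`= B_v` along `fixedPrimaryEquiv`), `fB = φ|_B`, `T = B ∩ M₀`
(`M₀ = nonsingularPart`, seen in `E(K̄)` — legitimate as `M ≤ E(K̄)^{I_v}`) and `ψT = φ|_T`:
`ker fB` is finite, `T` has finite index in `B`, and `[B : φ(B)] = [T : φ(T)] · p ^ ord_p c_v(E/K)`
(snake identity `index_range_mul_card_inf_ker_eq`; `ker fB =` the `D_v`-fixed `p`-power torsion,
`decompSubOne_eq_zero_iff`; `natCard_decompFixed_primary_eq_mul`).
[cite: GreenbergLNM1716, §3 Lemma 3.3 (proof, p. 87) and §4 proof of Thm. 4.1 (p. 74)] -/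
theorem index_range_primary_eq_mul [W.IsElliptic] (hpv : (p : 𝓞 K) ∉ v.asIdeal)
    {g : ↥((⊤ : Subgroup (absoluteGaloisGroup K)) ⊓ decomp v)}
    (hgen : ∀ U : Subgroup ↥((⊤ : Subgroup (absoluteGaloisGroup K)) ⊓ decomp v),
      IsOpen (U : Set ↥((⊤ : Subgroup (absoluteGaloisGroup K)) ⊓ decomp v)) →
        κ.kerSubgroup.subgroupOf ((⊤ : Subgroup (absoluteGaloisGroup K)) ⊓ decomp v) ≤ U →
          g ∈ U → U = ⊤)
    (fB : AddCommGroup.primaryComponent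
        ↥(FixedPoints.addSubgroup ↥(κ.kerSubgroup ⊓ decomp v) W.geomPoints) p →+
      AddCommGroup.primaryComponent
        ↥(FixedPoints.addSubgroup ↥(κ.kerSubgroup ⊓ decomp v) W.geomPoints) p)
    (hfB : ∀ b, (fB b : FixedPoints.addSubgroup ↥(κ.kerSubgroup ⊓ decomp v) W.geomPoints) =
      decompSubOne κ W.geomPoints (g : absoluteGaloisGroup K) (Subgroup.mem_inf.mp g.2).2 b)
    (T : AddSubgroup ↥(AddCommGroup.primaryComponent
        ↥(FixedPoints.addSubgroup ↥(κ.kerSubgroup ⊓ decomp v) W.geomPoints) p))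
    (hT : ∀ b, b ∈ T ↔ (((b : AddCommGroup.primaryComponent
        ↥(FixedPoints.addSubgroup ↥(κ.kerSubgroup ⊓ decomp v) W.geomPoints) p) :
          FixedPoints.addSubgroup ↥(κ.kerSubgroup ⊓ decomp v) W.geomPoints) : W.geomPoints) ∈
        (nonsingularPart W hW₀ Φ).map (FixedPoints.addSubgroup
          ↥((adicCompletionPrime K v).inertia (absoluteGaloisGroup K)) W.geomPoints).subtype)
    (ψT : T →+ T) (hψT : ∀ t, (ψT t : AddCommGroup.primaryComponent
        ↥(FixedPoints.addSubgroup ↥(κ.kerSubgroup ⊓ decomp v) W.geomPoints) p) = fB t) :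
    Finite fB.ker ∧ T.FiniteIndex ∧
      fB.range.index = ψT.range.index * p ^ padicValNat p
        ((W.baseChange (v.adicCompletion K)).localTamagawaNumber (v.adicCompletionIntegers K)) := by
  have hgD : (g : absoluteGaloisGroup K) ∈ decomp v := (Subgroup.mem_inf.mp g.2).2
  have hle := fixedPoints_kerSubgroup_inf_decomp_le_fixedPoints_inertia W κ hpv
  -- (1) `T` has finite index in `B`: `T` is the preimage of `M₀` under `B ↪ E(K̄)^{I_v}`
  haveI : (nonsingularPart W hW₀ Φ).FiniteIndex := finiteIndex_nonsingularPart hw hW₀ hΦ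
  have hTj : T = (nonsingularPart W hW₀ Φ).comap ((AddSubgroup.inclusion hle).comp
      (AddCommGroup.primaryComponent
        ↥(FixedPoints.addSubgroup ↥(κ.kerSubgroup ⊓ decomp v) W.geomPoints) p).subtype) := by
    ext b
    rw [hT, AddSubgroup.mem_comap]
    constructor
    · rintro ⟨y, hy, hyb⟩
      have : y = ((AddSubgroup.inclusion hle).comp (AddCommGroup.primaryComponent
          ↥(FixedPoints.addSubgroup ↥(κ.kerSubgroup ⊓ decomp v) W.geomPoints) p).subtype) b :=
        Subtype.ext hyb
      rwa [this] at hy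
    · intro h
      exact ⟨_, h, rfl⟩
  haveI hTfin : T.FiniteIndex := by
    rw [hTj]
    refine ⟨?_⟩
    rw [AddSubgroup.index_comap]
    exact AddSubgroup.FiniteIndex.index_ne_zero
  -- (2) `ker fB` and `T ⊓ ker fB` are the `D_v`-fixed `p`-power torsion points (resp. those in `M₀`)
  set S : Set W.geomPoints := {m | (∀ x ∈ decomp v, x • m = m) ∧ ∃ k : ℕ, p ^ k • m = 0} with hSdef
  set S₀ : Set W.geomPoints := {m | ((∀ x ∈ decomp v, x • m = m) ∧ ∃ k : ℕ, p ^ k • m = 0) ∧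
    m ∈ (nonsingularPart W hW₀ Φ).map (FixedPoints.addSubgroup
      ↥((adicCompletionPrime K v).inertia (absoluteGaloisGroup K)) W.geomPoints).subtype} with hS₀def
  have hkerS : ∀ b, b ∈ fB.ker ↔ (((b : AddCommGroup.primaryComponent
      ↥(FixedPoints.addSubgroup ↥(κ.kerSubgroup ⊓ decomp v) W.geomPoints) p) :
        FixedPoints.addSubgroup ↥(κ.kerSubgroup ⊓ decomp v) W.geomPoints) : W.geomPoints) ∈ S := by
    intro b
    rw [AddMonoidHom.mem_ker]
    constructor
    · intro h
      refine ⟨(decompSubOne_eq_zero_iff W κ hgen _).mp ?_, ?_⟩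
      · have := congrArg (fun z : AddCommGroup.primaryComponent
          ↥(FixedPoints.addSubgroup ↥(κ.kerSubgroup ⊓ decomp v) W.geomPoints) p ↦
            (z : FixedPoints.addSubgroup ↥(κ.kerSubgroup ⊓ decomp v) W.geomPoints)) h
        simpa only [hfB, ZeroMemClass.coe_zero] using this
      · obtain ⟨k, hk⟩ := (AddCommGroup.mem_primaryComponent).mp b.2
        refine ⟨k, ?_⟩
        have := congrArg (fun z : FixedPoints.addSubgroup ↥(κ.kerSubgroup ⊓ decomp v) W.geomPoints ↦
          (z : W.geomPoints)) hk
        simpa only [AddSubgroupClass.coe_nsmul, ZeroMemClass.coe_zero] using this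
    · rintro ⟨hfix, -⟩
      apply Subtype.ext
      rw [hfB, ZeroMemClass.coe_zero]
      exact (decompSubOne_eq_zero_iff W κ hgen _).mpr hfix
  -- every point of `S` comes from `ker fB`
  have hsurjS : ∀ m ∈ S, ∃ b : fB.ker, (((b : AddCommGroup.primaryComponent
      ↥(FixedPoints.addSubgroup ↥(κ.kerSubgroup ⊓ decomp v) W.geomPoints) p) :
        FixedPoints.addSubgroup ↥(κ.kerSubgroup ⊓ decomp v) W.geomPoints) : W.geomPoints) = m := by
    intro m hm
    have hmM : m ∈ FixedPoints.addSubgroup ↥(κ.kerSubgroup ⊓ decomp v) W.geomPoints :=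
      fun x ↦ hm.1 _ (Subgroup.mem_inf.mp x.2).2
    obtain ⟨k, hk⟩ := hm.2
    have hmB : (⟨m, hmM⟩ : FixedPoints.addSubgroup ↥(κ.kerSubgroup ⊓ decomp v) W.geomPoints) ∈
        AddCommGroup.primaryComponent
          ↥(FixedPoints.addSubgroup ↥(κ.kerSubgroup ⊓ decomp v) W.geomPoints) p :=
      (AddCommGroup.mem_primaryComponent).mpr ⟨k, Subtype.ext (by
        rw [AddSubgroupClass.coe_nsmul, ZeroMemClass.coe_zero]; exact hk)⟩
    exact ⟨⟨⟨⟨m, hmM⟩, hmB⟩, (hkerS ⟨⟨m, hmM⟩, hmB⟩).mpr hm⟩, rfl⟩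
  -- the bijections `ker fB ≃ S`, `T ⊓ ker fB ≃ S₀`
  have hcardker : Nat.card fB.ker = Nat.card S := by
    refine Nat.card_eq_of_bijective (fun b : fB.ker ↦ (⟨_, (hkerS b).mp b.2⟩ : S)) ⟨?_, ?_⟩
    · intro a b hab
      have h := congrArg Subtype.val hab
      dsimp only at h
      exact Subtype.ext (Subtype.ext (Subtype.ext h))
    · rintro ⟨m, hm⟩
      obtain ⟨b, hb⟩ := hsurjS m hm
      exact ⟨b, Subtype.ext hb⟩
  have hcardinf : Nat.card ↥(T ⊓ fB.ker) = Nat.card S₀ := by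
    refine Nat.card_eq_of_bijective (fun b : ↥(T ⊓ fB.ker) ↦ (⟨_, (hkerS b).mp
      (AddSubgroup.mem_inf.mp b.2).2, (hT b).mp (AddSubgroup.mem_inf.mp b.2).1⟩ : S₀)) ⟨?_, ?_⟩
    · intro a b hab
      have h := congrArg Subtype.val hab
      dsimp only at h
      exact Subtype.ext (Subtype.ext (Subtype.ext h))
    · rintro ⟨m, hm, hm₀⟩
      obtain ⟨b, hbm⟩ := hsurjS m hm
      refine ⟨⟨b, AddSubgroup.mem_inf.mpr ⟨(hT b).mpr (by rw [hbm]; exact hm₀), b.2⟩⟩,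
        Subtype.ext ?_⟩
      exact hbm
  have hfinker_of : Finite S → Finite fB.ker := fun _ ↦
    Finite.of_injective (fun b : fB.ker ↦ (⟨_, (hkerS b).mp b.2⟩ : S)) (by
      intro a b hab
      have h := congrArg Subtype.val hab
      dsimp only at h
      exact Subtype.ext (Subtype.ext (Subtype.ext h)))
  -- (3) finiteness of `ker fB`, the arithmetic, the snake identity
  haveI : Finite S := (finite_setOf_smul_decomp_eq_of_isPrimary W p hpv).to_subtype
  haveI hfinker : Finite fB.ker := hfinker_of inferInstance
  have harith : Nat.card S = Nat.card S₀ * p ^ padicValNat p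
      ((W.baseChange (v.adicCompletion K)).localTamagawaNumber (v.adicCompletionIntegers K)) :=
    natCard_decompFixed_primary_eq_mul hw hW₀ hΦ (p := p) hpv
  refine ⟨hfinker, hTfin, TamagawaCoinvariants.index_range_eq_mul_of_card_ker_eq fB T ψT hψT ?_⟩
  rw [hcardker, hcardinf]
  exact harith

/-! ## Data-free corollaries on `B_v = E[p^∞]^{ker κ ⊓ D_v}` -/
/-- **`p ^ ord_p c_v ∣ [B_v : (γ_v − 1)B_v]`** for `B_v = E[p^∞]^{ker κ ⊓ D_v}` (`W.geomPrimaryTorsion p`),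
at every finite place `v ∤ p`, for every `ℤ_p`-extension `κ` and every topological generator `γ_v`
of `D_v` modulo `D_v ⊓ ker κ` (no hypothesis on the reduction type or on the decomposition of `v`);
the lower half of "`#H¹(Γ_v, B_v) = c_v^{(p)}`" (Greenberg p. 74); the local data are supplied inside.
[cite: GreenbergLNM1716, §3 Lemma 3.3 (p. 87) and §4 proof of Thm. 4.1 (p. 74)]
[cite: SilvermanAEC2009, Thm. VII.6.1 / Cor. VII.6.2] -/
theorem pow_padicValNat_localTamagawaNumber_dvd_index_range_decompSubOne [W.IsElliptic]
    (hpv : (p : 𝓞 K) ∉ v.asIdeal)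
    {g : ↥((⊤ : Subgroup (absoluteGaloisGroup K)) ⊓ decomp v)}
    (hgen : ∀ U : Subgroup ↥((⊤ : Subgroup (absoluteGaloisGroup K)) ⊓ decomp v),
      IsOpen (U : Set ↥((⊤ : Subgroup (absoluteGaloisGroup K)) ⊓ decomp v)) →
        κ.kerSubgroup.subgroupOf ((⊤ : Subgroup (absoluteGaloisGroup K)) ⊓ decomp v) ≤ U →
          g ∈ U → U = ⊤) :
    p ^ padicValNat p
        ((W.baseChange (v.adicCompletion K)).localTamagawaNumber (v.adicCompletionIntegers K)) ∣
      (decompSubOne κ (W.geomPrimaryTorsion p) (g : absoluteGaloisGroup K)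
        (Subgroup.mem_inf.mp g.2).2).range.index := by
  -- local data
  obtain ⟨w, hw⟩ := v.exists_spectralValuation
  have hint := WeierstrassCurve.isIntegral_spectralValuation_baseChange hw
    (W.localMinimalIntegralModel v)
  obtain ⟨W₀, hW₀⟩ := hint.integral
  obtain ⟨C, hC⟩ := W.exists_variableChange_eq_localMinimalIntegralModel v
  obtain ⟨Φ, hΦ⟩ := W.exists_addEquiv_localPoints_of_smul_eq v hC
  have hgD : (g : absoluteGaloisGroup K) ∈ decomp v := (Subgroup.mem_inf.mp g.2).2
  -- `B = M[p^∞]`, `fB = (γ_v − 1)|_B`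
  let Mfix := FixedPoints.addSubgroup ↥(κ.kerSubgroup ⊓ decomp v) W.geomPoints
  let B : AddSubgroup Mfix := AddCommGroup.primaryComponent Mfix p
  let fB : B →+ B := ((decompSubOne κ W.geomPoints (g : absoluteGaloisGroup K) hgD).comp
    B.subtype).codRestrict B fun b ↦ PrimaryCoinvariants.map_mem_primaryComponent p
      (decompSubOne κ W.geomPoints (g : absoluteGaloisGroup K) hgD) b.2
  have hfB : ∀ b : B, (fB b : Mfix) = decompSubOne κ W.geomPoints (g : absoluteGaloisGroup K) hgD b :=
    fun _ ↦ rfl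
  -- `T = B ∩ M₀`
  let T : AddSubgroup B := (((nonsingularPart W hW₀ Φ).map (FixedPoints.addSubgroup
      ↥((adicCompletionPrime K v).inertia (absoluteGaloisGroup K)) W.geomPoints).subtype).comap
    Mfix.subtype).addSubgroupOf B
  have hT : ∀ b : B, b ∈ T ↔ ((b : Mfix) : W.geomPoints) ∈ (nonsingularPart W hW₀ Φ).map
      (FixedPoints.addSubgroup ↥((adicCompletionPrime K v).inertia (absoluteGaloisGroup K))
        W.geomPoints).subtype := fun b ↦ by
    rw [AddSubgroup.mem_addSubgroupOf, AddSubgroup.mem_comap]; rfl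
  -- `T` is `fB`-stable (`M₀` is `D_v`-stable)
  have hTstab : ∀ b ∈ T, fB b ∈ T := by
    intro b hb
    rw [hT] at hb ⊢
    obtain ⟨y, hy, hyb⟩ := hb
    have hyb' : (y : W.geomPoints) = ((b : Mfix) : W.geomPoints) := hyb
    have hgy := smul_mem_nonsingularPart hw hW₀ hΦ hgD hy
    refine ⟨⟨(g : absoluteGaloisGroup K) • (y : W.geomPoints), smul_mem_fixedPoints_inertia
      W.geomPoints hgD y.2⟩ - y, sub_mem hgy hy, ?_⟩
    rw [map_sub]
    change (g : absoluteGaloisGroup K) • (y : W.geomPoints) - (y : W.geomPoints) =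
      (((fB b : B) : Mfix) : W.geomPoints)
    rw [hfB, coe_decompSubOne_apply, hyb']
  let ψT : T →+ T := (fB.comp T.subtype).codRestrict T fun t ↦ hTstab t t.2
  have hψT : ∀ t : T, (ψT t : B) = fB t := fun _ ↦ rfl
  obtain ⟨-, -, hidx⟩ := index_range_primary_eq_mul W κ hw hW₀ hΦ hpv hgen fB hfB T hT ψT hψT
  -- transport to `B_v` along `fixedPrimaryEquiv`
  have he : AddSubgroup.map (fixedPrimaryEquiv W κ (v := v) : _ →+ B)
      (decompSubOne κ (W.geomPrimaryTorsion p) (g : absoluteGaloisGroup K) hgD).range = fB.range := by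
    ext b
    constructor
    · rintro ⟨x, ⟨y, rfl⟩, rfl⟩
      exact ⟨fixedPrimaryEquiv W κ y, Subtype.ext (Subtype.ext rfl)⟩
    · rintro ⟨y, rfl⟩
      exact ⟨decompSubOne κ (W.geomPrimaryTorsion p) (g : absoluteGaloisGroup K) hgD
        ((fixedPrimaryEquiv W κ).symm y), ⟨(fixedPrimaryEquiv W κ).symm y, rfl⟩,
        Subtype.ext (Subtype.ext rfl)⟩
  have hcongr : (decompSubOne κ (W.geomPrimaryTorsion p) (g : absoluteGaloisGroup K) hgD).range.index =
      fB.range.index := by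
    rw [AddSubgroup.index_eq_card, AddSubgroup.index_eq_card]
    exact Nat.card_congr (QuotientAddGroup.congr _ _ (fixedPrimaryEquiv W κ (v := v)) he).toEquiv
  rw [hcongr, hidx]
  exact Dvd.intro_left _ rfl

/-- **`[B_v : (γ_v − 1)B_v] = p ^ ord_p c_v` — Greenberg's "`H¹(Γ_v, B_v)` has order `c_v^{(p)}`"
(LNM 1716, proof of Thm. 4.1, p. 74) on the constructed objects**, for `B_v = E[p^∞]^{ker κ ⊓ D_v}`,
every finite place `v ∤ p` that does NOT split completely in `K_∞/K` (`¬ D_v ≤ ker κ`), every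
`ℤ_p`-extension `κ` and every topological generator `γ_v` of `D_v` modulo `D_v ⊓ ker κ`. Squeeze:
`p ^ ord_p c_v ∣ [B_v : (γ_v − 1)B_v]` (this file) `= #ker r_v` (sibling sub-cell multr1-p1,
`natCard_localKer_eq_natCard_quotient_range_decompSubOne`) `≤ p ^ ord_p c_v` (gen 14,
`natCard_localKer_le_pow_padicValNat_localTamagawaNumber`).
[cite: GreenbergLNM1716, §3 Lemma 3.3 (p. 87) and §4 proof of Thm. 4.1 (p. 74)] -/
theorem index_range_decompSubOne_eq_pow [W.IsElliptic] (hpv : (p : 𝓞 K) ∉ v.asIdeal)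
    (hv : ¬ decomp v ≤ κ.kerSubgroup)
    {g : ↥((⊤ : Subgroup (absoluteGaloisGroup K)) ⊓ decomp v)}
    (hgen : ∀ U : Subgroup ↥((⊤ : Subgroup (absoluteGaloisGroup K)) ⊓ decomp v),
      IsOpen (U : Set ↥((⊤ : Subgroup (absoluteGaloisGroup K)) ⊓ decomp v)) →
        κ.kerSubgroup.subgroupOf ((⊤ : Subgroup (absoluteGaloisGroup K)) ⊓ decomp v) ≤ U →
          g ∈ U → U = ⊤) :
    (decompSubOne κ (W.geomPrimaryTorsion p) (g : absoluteGaloisGroup K)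
        (Subgroup.mem_inf.mp g.2).2).range.index =
      p ^ padicValNat p
        ((W.baseChange (v.adicCompletion K)).localTamagawaNumber (v.adicCompletionIntegers K)) := by
  have hprim : IsPrimaryTorsion p (W.geomPrimaryTorsion p) := fun Q ↦
    (AddCommGroup.mem_primaryComponent.mp Q.2).imp fun k hk ↦
      Subtype.ext (by rw [AddSubmonoidClass.coe_nsmul, hk, ZeroMemClass.coe_zero])
  have htr := natCard_localKer_eq_natCard_quotient_range_decompSubOne κ (W.geomPrimaryTorsion p)
    (W.continuous_smul_geomPrimaryTorsion p) hprim hv hgen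
  obtain ⟨hfin, hle⟩ := natCard_localKer_le_pow_padicValNat_localTamagawaNumber W κ hpv
  haveI := hfin
  have hdvd := pow_padicValNat_localTamagawaNumber_dvd_index_range_decompSubOne W κ hpv hgen
  rw [AddSubgroup.index_eq_card, ← htr] at hdvd ⊢
  have hpos : 0 < Nat.card (localKer κ.kerSubgroup (W.geomPrimaryTorsion p) v) := Nat.card_pos
  exact le_antisymm hle (Nat.le_of_dvd hpos hdvd)

end Coinvariants

/-! ## Atom (P11) (`K : Type`, as in `AnticyclotomicControlAtoms`) -/
section P11

variable {K : Type} [Field K] [NumberField K] (W : WeierstrassCurve K) {p : ℕ} [Fact p.Prime]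
  (κ : ZpExtension K p) {v : HeightOneSpectrum (𝓞 K)}

/-- **Atom (P11) `LocalKernelOrderAt` modulo the inflation–restriction transport.** For `v ∤ p`, if
`#ker r_v = #(B_v/(γ_v − 1)B_v)` for some topological generator `γ_v` of `D_v` modulo `D_v ⊓ ker κ`
(the sibling's `natCard_localKer_eq_natCard_quotient_range_decompSubOne` when `v` is finitely
decomposed), then `#ker r_v = p ^ ord_p c_v(E/K)`: the index is divisible by `c_v^{(p)}` (above) and
at most `c_v^{(p)}` (gen 14, `natCard_localKer_le_pow_padicValNat_localTamagawaNumber`).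
[cite: GreenbergLNM1716, §3 Lemma 3.3 (p. 87) and §4 proof of Thm. 4.1 (p. 74)]
[cite: JetchevSkinnerWan2017, Prop. 3.3.4 Case 1(a) (arXiv:1512.06894 pp. 12–13)] -/
theorem localKernelOrderAt_of_natCard_localKer_eq [W.IsElliptic] (hpv : (p : 𝓞 K) ∉ v.asIdeal)
    {g : ↥((⊤ : Subgroup (absoluteGaloisGroup K)) ⊓ decomp v)}
    (hgen : ∀ U : Subgroup ↥((⊤ : Subgroup (absoluteGaloisGroup K)) ⊓ decomp v),
      IsOpen (U : Set ↥((⊤ : Subgroup (absoluteGaloisGroup K)) ⊓ decomp v)) →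
        κ.kerSubgroup.subgroupOf ((⊤ : Subgroup (absoluteGaloisGroup K)) ⊓ decomp v) ≤ U →
          g ∈ U → U = ⊤)
    (htransport : Nat.card (localKer κ.kerSubgroup (W.geomPrimaryTorsion p) v) =
      Nat.card (FixedPoints.addSubgroup ↥(κ.kerSubgroup ⊓ decomp v) (W.geomPrimaryTorsion p) ⧸
        (decompSubOne κ (W.geomPrimaryTorsion p) (g : absoluteGaloisGroup K)
          (Subgroup.mem_inf.mp g.2).2).range)) :
    LocalKernelOrderAt W p κ v := by
  obtain ⟨hfin, hle⟩ := natCard_localKer_le_pow_padicValNat_localTamagawaNumber W κ hpv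
  haveI := hfin
  have hdvd := pow_padicValNat_localTamagawaNumber_dvd_index_range_decompSubOne W κ hpv hgen
  rw [AddSubgroup.index_eq_card, ← htransport] at hdvd
  have hpos : 0 < Nat.card (localKer κ.kerSubgroup (W.geomPrimaryTorsion p) v) := Nat.card_pos
  exact ⟨hfin, le_antisymm hle (Nat.le_of_dvd hpos hdvd)⟩

/-- **Atom (P11) `LocalKernelOrderAt` DISCHARGED at every finitely decomposed place.** For an
elliptic curve `E` over a number field `K`, a prime `p`, a `ℤ_p`-extension `κ`, and a finite place
`v ∤ p` that does not split completely in `K_∞ = K̄^{ker κ}` (`¬ D_v ≤ ker κ`): Greenberg's local kernel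
`ker r_v = ker (H¹(K_v, E[p^∞]) → H¹(K_{∞,w}, E[p^∞]))` is finite of order EXACTLY `p ^ ord_p c_v(E/K)`
(LNM 1716, proof of Thm. 4.1, p. 74; JSW17 Prop. 3.3.4 Case 1(a)/2(a)). All inputs are theorems of
the tree: the coinvariant identity and purity count of this sub-cell, and the inflation–restriction
equality of the sibling sub-cell. For the anticyclotomic `κ` at a place `w ∤ p` over a prime split in
the imaginary quadratic `K` the hypothesis holds (Brink; the sibling's cited input), so route R1's
typed `R1LocalKernelOrderAt` follows there. [cite: GreenbergLNM1716, §3 Lemma 3.3 (p. 87) and §4 proof of Thm. 4.1 (p. 74)]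
[cite: JetchevSkinnerWan2017, Prop. 3.3.4 Case 1(a) (arXiv:1512.06894 pp. 12–13)] -/
theorem localKernelOrderAt_of_not_le [W.IsElliptic] (hpv : (p : 𝓞 K) ∉ v.asIdeal)
    (hv : ¬ decomp v ≤ κ.kerSubgroup) : LocalKernelOrderAt W p κ v := by
  have hprim : IsPrimaryTorsion p (W.geomPrimaryTorsion p) := fun Q ↦
    (AddCommGroup.mem_primaryComponent.mp Q.2).imp fun k hk ↦
      Subtype.ext (by rw [AddSubmonoidClass.coe_nsmul, hk, ZeroMemClass.coe_zero])
  obtain ⟨g, hgen⟩ := exists_mem_decomp_generate κ v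
  exact localKernelOrderAt_of_natCard_localKer_eq W κ hpv hgen
    (natCard_localKer_eq_natCard_quotient_range_decompSubOne κ (W.geomPrimaryTorsion p)
      (W.continuous_smul_geomPrimaryTorsion p) hprim hv hgen)

end P11

end Summit.BirchSwinnertonDyer.Rank1Residual.X11b.AcSelmer

end
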